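/-
Copyright (c) 2026. All rights reserved.
Released under Apache 2.0 license as described in the file LICENSE.
-/
import Literature.Probability.LatticeModels.FourFunctionsEqualityLattice
import Literature.Probability.LatticeModels.FKGEqualityChainsSupport
import HarnessLib

/-!
# Equality in the Ahlswede–Daykin inequality on a direct product of chains (Chan–Pak 2026, Thm. 8.3)

[ChanPak2026] S. H. Chan and I. Pak, *Equality conditions for correlation inequalities*, arXiv:2607.06275
(2026), §8.4.

## Source, verbatim (pp. 28–29)

"**8.4. AD equality for products of chains.**  A *direct product of chains* is a lattice
(8.5) `L = L(N₁, …, N_n) := C_{N₁} × ··· × C_{N_n}`, where `i`-th chain `C_{N_i}` has elements in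
`[N_i] = {1, …, N_i}`, and the join and meet operations are given by pointwise maximum and minimum,
respectively.

**Theorem 8.3 (AD equality for direct products of chains).**  Let `L = (L, ∨, ∧)` be a direct product of
`n` chains as in (8.5).  Let `a, b, c, d : L → ℝ≥0` be functions satisfying condition (AD-cond).  Then (AD-eq)
holds if and only if there exist a subset `A ⊆ [n]`, lattices `L₁ := ⊗_{i∈A} C_{N_i}`,
`L₂ := ⊗_{j∉A} C_{N_j}`, functions `f₁, g₁ : L₁ → ℝ≥0`, `f₂, g₂ : L₂ → ℝ≥0`, and nonnegative constants
`α, β, γ, δ ≥ 0` such that `αβ = γδ`, and (1.2) holds."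

"*Proof of Theorem 8.3.*  It follows from Theorem 1.3 that the lattice closure of `supp(a + b + c + d)` is
isomorphic `L₁ × L₂` for some finite distributive lattices `L₁`, `L₂`.  Furthermore, there exist
`α, β, γ, δ > 0`, such that `αβ = γδ`, and (1.2) holds.  Let `ι : L₁ × L₂ → L` be the given embedding.  Apply
Lemma 8.4 to `ι`, to obtain a subset `A ⊆ [n]`.  By the lemma, we can identify `L₁` and `L₂` with
sublattices of `⊗_{i∈A} C_{N_i}` and `⊗_{j∉A} C_{N_j}`, respectively.  We now formally embed `L₁` into the
product of chains `⊗_{i∈A} C_{N_i}`, and then extend the functions `f₁, g₁ : L₁ → ℝ≥0` to this entire space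
by setting them to be zero outside the original `L₁`.  We apply the same extension to `L₂, f₂, g₂`.  The
theorem now follows immediately from (1.2)." (p. 29)

## What is formalised

The product of chains is `Π i : ι, C i` for a finite index type `ι` and finite linear orders `C i` (the
vocabulary of `FKGEqualityChains.lean`: `DetBy h A` = "`h` depends only on the coordinates in `A`",
`mix A x y = (x_A, y_{Aᶜ})`).  As for Thm. 9.1 in `FKGEqualityChainsSupport.lean`, the functions on
`L₁ = ⊗_{i∈A} C_i`, `L₂ = ⊗_{j∉A} C_j` are rendered as functions on `L` determined by `A`, resp. `Aᶜ`.

* `adEq_of_crossFactor_pi` — (⇐), for any real `a, b, c, d` (substitute and sum along the exchange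
  involution `FKGEqualityChains.mixEquiv`).
* `exists_crossFactor_pi_of_adEq` — (⇒), the printed proof: Theorem 1.3 (`crossFactorOn_of_adEq` of
  `FourFunctionsEqualityLattice.lean`) on the lattice closure `K` of the support (a distributive sublattice,
  `Subtype.distribLattice`; its own closure hypothesis by Mathlib `image_latticeClosure`), Lemma 8.4
  (`FKGEqualityChains.alignedSet`, `fst_eq_of_agree_alignedSet`, `snd_eq_of_agree_alignedSet`,
  `apply_mk_fst_snd` of `FKGEqualityChainsSupport.lean`) for the embedding `L₁ × L₂ ≃ K ⊆ L`, and the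
  extension by zero (a point of `L` with both an `A`-witness and an `Aᶜ`-witness glues to a point of `K`).
* `chanPak_thm83` — Theorem 8.3 as an `iff`.
-/

noncomputable section

open scoped Classical

namespace Literature.Probability.LatticeModels.FourFunctionsEquality

open Finset Function

open FKGEqualityChains (DetBy mix mixEquiv alignedSet fst_eq_of_agree_alignedSet snd_eq_of_agree_alignedSet
  apply_mk_fst_snd)

section Chains

variable {ι : Type*} {C : ι → Type*}

/-- `mix A x y` agrees with `x` on `A`. [folklore] -/
private theorem mix_agree_left' (A : Set ι) (x y : ∀ i, C i) : ∀ i ∈ A, mix A x y i = x i :=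
  fun i hi => by simp only [mix, if_pos hi]

/-- `mix A x y` agrees with `y` off `A`. [folklore] -/
private theorem mix_agree_right' (A : Set ι) (x y : ∀ i, C i) : ∀ i ∈ Aᶜ, mix A x y i = y i :=
  fun i hi => by simp only [mix, if_neg (show i ∉ A from hi)]

variable [Fintype ι] [DecidableEq ι] [∀ i, Fintype (C i)] [∀ i, LinearOrder (C i)]

omit [∀ i, LinearOrder (C i)] in
/-- **Theorem 8.3 (⇐)**: if `a = α f₁ f₂`, `b = β g₁ g₂`, `c = γ f₁ g₂`, `d = δ g₁ f₂` with `f₁, g₁` read on the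
coordinates in `A`, `f₂, g₂` on those off `A`, and `αβ = γδ`, then `Σa · Σb = Σc · Σd` ("the ⇐ direction is
clear": `a(x) b(y) = c(x_A, y_{Aᶜ}) d(y_A, x_{Aᶜ})` pointwise, summed along the exchange involution).  No sign or
(AD-cond) hypothesis is needed. [cite: ChanPak2026, Thm. 8.3 (⇐)] -/
theorem adEq_of_crossFactor_pi {a b c d f₁ g₁ f₂ g₂ : (∀ i, C i) → ℝ} {A : Set ι} {α β γ δ : ℝ}
    (hf₁ : DetBy f₁ A) (hg₁ : DetBy g₁ A) (hf₂ : DetBy f₂ Aᶜ) (hg₂ : DetBy g₂ Aᶜ) (hαβ : α * β = γ * δ)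
    (hX : ∀ x, a x = α * f₁ x * f₂ x ∧ b x = β * g₁ x * g₂ x ∧ c x = γ * f₁ x * g₂ x ∧ d x = δ * g₁ x * f₂ x) :
    (∑ x, a x) * ∑ x, b x = (∑ x, c x) * ∑ x, d x := by
  have hcross : ∀ x y, a x * b y = c (mix A x y) * d (mix A y x) := by
    intro x y
    rw [(hX x).1, (hX y).2.1, (hX (mix A x y)).2.2.1, (hX (mix A y x)).2.2.2,
      hf₁ (mix A x y) x (mix_agree_left' A x y), hg₂ (mix A x y) y (mix_agree_right' A x y),
      hg₁ (mix A y x) y (mix_agree_left' A y x), hf₂ (mix A y x) x (mix_agree_right' A y x)]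
    linear_combination (f₁ x * f₂ x * g₁ y * g₂ y) * hαβ
  rw [Finset.sum_mul_sum, Finset.sum_mul_sum, ← Fintype.sum_prod_type', ← Fintype.sum_prod_type',
    ← Equiv.sum_comp (mixEquiv A) (fun p : (∀ i, C i) × (∀ i, C i) => c p.1 * d p.2)]
  exact Fintype.sum_congr _ _ fun p => hcross p.1 p.2

omit [∀ i, LinearOrder (C i)] in
/-- A sum of a function vanishing off `K` is the sum over `K`. [folklore] -/
private theorem sum_eq_sum_subtype {K : Set (∀ i, C i)} {f : (∀ i, C i) → ℝ} (hf : ∀ x, f x ≠ 0 → x ∈ K) :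
    ∑ x, f x = ∑ s : {x // x ∈ K}, f s := by
  calc ∑ x, f x = ∑ x ∈ Finset.univ.filter (fun x => x ∈ K), f x :=
        (Finset.sum_filter_of_ne fun x _ hx => hf x hx).symm
    _ = ∑ s : {x // x ∈ K}, f s :=
        Finset.sum_subtype _ (fun x => by simp only [Finset.mem_filter, Finset.mem_univ, true_and]) f

/-- **Theorem 8.3 (⇒), [ChanPak2026]** — the printed proof.  For `a, b, c, d ≥ 0` on a product of finite chains
satisfying (AD-cond) and (AD-eq) there are `A ⊆ ι`, nonnegative `f₁, g₁` determined by the coordinates in `A`,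
`f₂, g₂` determined by those off `A`, and constants `α, β, γ, δ ≥ 0` with `αβ = γδ` such that (1.2) holds on all
of `L`: `a = α f₁ f₂`, `b = β g₁ g₂`, `c = γ f₁ g₂`, `d = δ g₁ f₂`. [cite: ChanPak2026, Thm. 8.3 (⇒)] -/
theorem exists_crossFactor_pi_of_adEq {a b c d : (∀ i, C i) → ℝ} (ha : ∀ x, 0 ≤ a x) (hb : ∀ x, 0 ≤ b x)
    (hc : ∀ x, 0 ≤ c x) (hd : ∀ x, 0 ≤ d x) (hAD : ∀ x y, a x * b y ≤ c (x ⊔ y) * d (x ⊓ y))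
    (heq : (∑ x, a x) * ∑ x, b x = (∑ x, c x) * ∑ x, d x) :
    ∃ (A : Set ι) (f₁ g₁ f₂ g₂ : (∀ i, C i) → ℝ) (α β γ δ : ℝ),
      (∀ x, 0 ≤ f₁ x) ∧ (∀ x, 0 ≤ g₁ x) ∧ (∀ x, 0 ≤ f₂ x) ∧ (∀ x, 0 ≤ g₂ x) ∧
      DetBy f₁ A ∧ DetBy g₁ A ∧ DetBy f₂ Aᶜ ∧ DetBy g₂ Aᶜ ∧
      0 ≤ α ∧ 0 ≤ β ∧ 0 ≤ γ ∧ 0 ≤ δ ∧ α * β = γ * δ ∧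
      ∀ x, a x = α * f₁ x * f₂ x ∧ b x = β * g₁ x * g₂ x ∧ c x = γ * f₁ x * g₂ x ∧ d x = δ * g₁ x * f₂ x := by
  -- the empty support: everything vanishes
  by_cases hne : ∃ x, 0 < a x + b x + c x + d x
  swap
  · have h0 : ∀ x, a x = 0 ∧ b x = 0 ∧ c x = 0 ∧ d x = 0 := fun x => by
      have hs : a x + b x + c x + d x ≤ 0 := not_lt.1 fun h => hne ⟨x, h⟩
      refine ⟨?_, ?_, ?_, ?_⟩ <;> linarith [ha x, hb x, hc x, hd x]
    refine ⟨Set.univ, fun _ => 0, fun _ => 0, fun _ => 0, fun _ => 0, 0, 0, 0, 0, fun _ => le_rfl,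
      fun _ => le_rfl, fun _ => le_rfl, fun _ => le_rfl, fun _ _ _ => rfl, fun _ _ _ => rfl, fun _ _ _ => rfl,
      fun _ _ _ => rfl, le_rfl, le_rfl, le_rfl, le_rfl, by ring, fun x => ?_⟩
    simp only [mul_zero]
    exact h0 x
  obtain ⟨x₀, hx₀⟩ := hne
  -- the lattice closure `K` of the support, a distributive sublattice
  obtain ⟨K, hK⟩ : ∃ K : Set (∀ i, C i), K = latticeClosure {x | 0 < a x + b x + c x + d x} := ⟨_, rfl⟩
  have Ksup : ∀ ⦃s t : ∀ i, C i⦄, s ∈ K → t ∈ K → s ⊔ t ∈ K := fun s t hs ht => by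
    rw [hK] at hs ht ⊢; exact isSublattice_latticeClosure.supClosed hs ht
  have Kinf : ∀ ⦃s t : ∀ i, C i⦄, s ∈ K → t ∈ K → s ⊓ t ∈ K := fun s t hs ht => by
    rw [hK] at hs ht ⊢; exact isSublattice_latticeClosure.infClosed hs ht
  letI : DistribLattice {x : ∀ i, C i // x ∈ K} := Subtype.distribLattice Ksup Kinf
  have hsuppK : ∀ x, 0 < a x + b x + c x + d x → x ∈ K := fun x hx => by
    rw [hK]; exact subset_latticeClosure hx
  have haK : ∀ x, a x ≠ 0 → x ∈ K := fun x hx =>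
    hsuppK x (by have := lt_of_le_of_ne (ha x) (Ne.symm hx); linarith [hb x, hc x, hd x])
  have hbK : ∀ x, b x ≠ 0 → x ∈ K := fun x hx =>
    hsuppK x (by have := lt_of_le_of_ne (hb x) (Ne.symm hx); linarith [ha x, hc x, hd x])
  have hcK : ∀ x, c x ≠ 0 → x ∈ K := fun x hx =>
    hsuppK x (by have := lt_of_le_of_ne (hc x) (Ne.symm hx); linarith [ha x, hb x, hd x])
  have hdK : ∀ x, d x ≠ 0 → x ∈ K := fun x hx =>
    hsuppK x (by have := lt_of_le_of_ne (hd x) (Ne.symm hx); linarith [ha x, hb x, hc x])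
  -- the hypotheses of Theorem 1.3 for the restrictions to `K`
  have hclK : latticeClosure {s : {x : ∀ i, C i // x ∈ K} | 0 < a s + b s + c s + d s} = Set.univ := by
    apply Set.eq_univ_of_forall
    intro s
    have himg := image_latticeClosure {s : {x : ∀ i, C i // x ∈ K} | 0 < a s + b s + c s + d s}
      (Subtype.val : {x : ∀ i, C i // x ∈ K} → ∀ i, C i) (fun _ _ => rfl) (fun _ _ => rfl)
    have hT : Subtype.val '' {s : {x : ∀ i, C i // x ∈ K} | 0 < a s + b s + c s + d s} =
        {x | 0 < a x + b x + c x + d x} := by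
      ext x
      constructor
      · rintro ⟨s, hs, rfl⟩; exact hs
      · intro hx; exact ⟨⟨x, hsuppK x hx⟩, hx, rfl⟩
    rw [hT, ← hK] at himg
    have hs : (s : ∀ i, C i) ∈ Subtype.val ''
        latticeClosure {s : {x : ∀ i, C i // x ∈ K} | 0 < a s + b s + c s + d s} := by
      rw [himg]; exact s.2
    obtain ⟨t, ht, hts⟩ := hs
    exact Subtype.ext hts ▸ ht
  have hADK : ∀ s t : {x : ∀ i, C i // x ∈ K},
      a s * b t ≤ c (↑(s ⊔ t) : ∀ i, C i) * d (↑(s ⊓ t) : ∀ i, C i) := fun s t => hAD s t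
  have heqK : (∑ s : {x : ∀ i, C i // x ∈ K}, a s) * ∑ s : {x : ∀ i, C i // x ∈ K}, b s =
      (∑ s : {x : ∀ i, C i // x ∈ K}, c s) * ∑ s : {x : ∀ i, C i // x ∈ K}, d s := by
    rw [← sum_eq_sum_subtype haK, ← sum_eq_sum_subtype hbK, ← sum_eq_sum_subtype hcK,
      ← sum_eq_sum_subtype hdK]
    exact heq
  -- Theorem 1.3 on `K`
  obtain ⟨L₁, L₂, _, _, _, _, e, f₁, g₁, f₂, g₂, α, β, γ, δ, hf₁, hg₁, hf₂, hg₂, hα, hβ, hγ, hδ, hαβ, hX⟩ :=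
    crossFactorOn_of_adEq (L := {x : ∀ i, C i // x ∈ K}) (fun s => ha s) (fun s => hb s) (fun s => hc s)
      (fun s => hd s) hADK hclK heqK
  -- the factors are nonempty finite lattices: bounded
  haveI : Nonempty L₁ := ⟨(e ⟨x₀, hsuppK x₀ hx₀⟩).1⟩
  haveI : Nonempty L₂ := ⟨(e ⟨x₀, hsuppK x₀ hx₀⟩).2⟩
  letI : BoundedOrder L₁ := Fintype.toBoundedOrder L₁
  letI : BoundedOrder L₂ := Fintype.toBoundedOrder L₂
  -- Lemma 8.4 for the lattice embedding `φ = e⁻¹ : L₁ × L₂ → K ⊆ L`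
  set φ : L₁ × L₂ → ∀ i, C i := fun p => ((e.symm p : {x : ∀ i, C i // x ∈ K}) : ∀ i, C i) with hφ
  have hsup : ∀ p q, φ (p ⊔ q) = φ p ⊔ φ q := fun p q => by
    simp only [hφ, OrderIso.map_sup]; rfl
  have hinf : ∀ p q, φ (p ⊓ q) = φ p ⊓ φ q := fun p q => by
    simp only [hφ, OrderIso.map_inf]; rfl
  have hinj : Injective φ := fun p q h => e.symm.injective (Subtype.ext h)
  have hφe : ∀ s : {x : ∀ i, C i // x ∈ K}, φ (e s) = s := fun s => by
    simp only [hφ, OrderIso.symm_apply_apply]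
  have hφK : ∀ p, φ p ∈ K := fun p => (e.symm p).2
  set A : Set ι := alignedSet φ with hA
  -- witnesses and the component read-off (Lemma 8.4)
  have hwit₁ : ∀ s : {x : ∀ i, C i // x ∈ K}, ∃ p : L₁ × L₂, ∀ i ∈ A, φ p i = (s : ∀ i, C i) i :=
    fun s => ⟨e s, fun i _ => by rw [hφe]⟩
  have hwit₂ : ∀ s : {x : ∀ i, C i // x ∈ K}, ∃ p : L₁ × L₂, ∀ i ∉ A, φ p i = (s : ∀ i, C i) i :=
    fun s => ⟨e s, fun i _ => by rw [hφe]⟩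
  have hfst : ∀ (s : {x : ∀ i, C i // x ∈ K}) (h : ∃ p : L₁ × L₂, ∀ i ∈ A, φ p i = (s : ∀ i, C i) i),
      h.choose.1 = (e s).1 := fun s h =>
    fst_eq_of_agree_alignedSet hsup hinf hinj fun i hi => by rw [h.choose_spec i hi, hφe]
  have hsnd : ∀ (s : {x : ∀ i, C i // x ∈ K}) (h : ∃ p : L₁ × L₂, ∀ i ∉ A, φ p i = (s : ∀ i, C i) i),
      h.choose.2 = (e s).2 := fun s h =>
    snd_eq_of_agree_alignedSet hsup hinf hinj fun i hi => by rw [h.choose_spec i hi, hφe]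
  -- extension by zero ("formally embed `L₁` into `⊗_{i∈A} C_i` … zero outside the original `L₁`")
  obtain ⟨E₁, hE₁⟩ : ∃ E₁ : (L₁ → ℝ) → (∀ i, C i) → ℝ, ∀ F x,
      E₁ F x = if h : ∃ p : L₁ × L₂, ∀ i ∈ A, φ p i = x i then F h.choose.1 else 0 := ⟨_, fun _ _ => rfl⟩
  obtain ⟨E₂, hE₂⟩ : ∃ E₂ : (L₂ → ℝ) → (∀ i, C i) → ℝ, ∀ F x,
      E₂ F x = if h : ∃ p : L₁ × L₂, ∀ i ∉ A, φ p i = x i then F h.choose.2 else 0 := ⟨_, fun _ _ => rfl⟩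
  have hdet₁ : ∀ F : L₁ → ℝ, DetBy (E₁ F) A := by
    intro F x y hxy
    rw [hE₁, hE₁]
    by_cases hx : ∃ p : L₁ × L₂, ∀ i ∈ A, φ p i = x i
    · have hy : ∃ p : L₁ × L₂, ∀ i ∈ A, φ p i = y i := hx.imp fun p hp i hi => (hp i hi).trans (hxy i hi)
      simp only [dif_pos hx, dif_pos hy]
      congr 1
      exact fst_eq_of_agree_alignedSet hsup hinf hinj fun i hi => by
        rw [hx.choose_spec i hi, hy.choose_spec i hi, hxy i hi]
    · have hy : ¬∃ p : L₁ × L₂, ∀ i ∈ A, φ p i = y i :=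
        fun hy => hx (hy.imp fun p hp i hi => (hp i hi).trans (hxy i hi).symm)
      simp only [dif_neg hx, dif_neg hy]
  have hdet₂ : ∀ F : L₂ → ℝ, DetBy (E₂ F) Aᶜ := by
    intro F x y hxy
    rw [hE₂, hE₂]
    by_cases hx : ∃ p : L₁ × L₂, ∀ i ∉ A, φ p i = x i
    · have hy : ∃ p : L₁ × L₂, ∀ i ∉ A, φ p i = y i := hx.imp fun p hp i hi => (hp i hi).trans (hxy i hi)
      simp only [dif_pos hx, dif_pos hy]
      congr 1
      exact snd_eq_of_agree_alignedSet hsup hinf hinj fun i hi => by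
        rw [hx.choose_spec i hi, hy.choose_spec i hi, hxy i hi]
    · have hy : ¬∃ p : L₁ × L₂, ∀ i ∉ A, φ p i = y i :=
        fun hy => hx (hy.imp fun p hp i hi => (hp i hi).trans (hxy i hi).symm)
      simp only [dif_neg hx, dif_neg hy]
  have hval₁ : ∀ (F : L₁ → ℝ) (x : ∀ i, C i) (hx : x ∈ K), E₁ F x = F (e ⟨x, hx⟩).1 := by
    intro F x hx
    rw [hE₁, dif_pos (hwit₁ ⟨x, hx⟩), hfst ⟨x, hx⟩]
  have hval₂ : ∀ (F : L₂ → ℝ) (x : ∀ i, C i) (hx : x ∈ K), E₂ F x = F (e ⟨x, hx⟩).2 := by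
    intro F x hx
    rw [hE₂, dif_pos (hwit₂ ⟨x, hx⟩), hsnd ⟨x, hx⟩]
  have hnn₁ : ∀ F : L₁ → ℝ, (∀ y, 0 ≤ F y) → ∀ x, 0 ≤ E₁ F x := fun F hF x => by
    rw [hE₁]
    by_cases h : ∃ p : L₁ × L₂, ∀ i ∈ A, φ p i = x i
    · rw [dif_pos h]; exact hF _
    · rw [dif_neg h]
  have hnn₂ : ∀ F : L₂ → ℝ, (∀ y, 0 ≤ F y) → ∀ x, 0 ≤ E₂ F x := fun F hF x => by
    rw [hE₂]
    by_cases h : ∃ p : L₁ × L₂, ∀ i ∉ A, φ p i = x i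
    · rw [dif_pos h]; exact hF _
    · rw [dif_neg h]
  -- off `K`: a point with both witnesses would glue to a point of `K`
  have hoff : ∀ (F : L₁ → ℝ) (G : L₂ → ℝ) (x : ∀ i, C i), x ∉ K → E₁ F x * E₂ G x = 0 := by
    intro F G x hx
    rw [hE₁, hE₂]
    by_cases h1 : ∃ p : L₁ × L₂, ∀ i ∈ A, φ p i = x i
    · by_cases h2 : ∃ p : L₁ × L₂, ∀ i ∉ A, φ p i = x i
      · exfalso
        have hglue : φ (h1.choose.1, h2.choose.2) = x := by
          funext i
          rw [apply_mk_fst_snd hsup hinf]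
          split_ifs with hi
          · exact h1.choose_spec i hi
          · exact h2.choose_spec i hi
        exact hx (hglue ▸ hφK _)
      · rw [dif_neg h2, mul_zero]
    · rw [dif_neg h1, zero_mul]
  have hzero : ∀ x, x ∉ K → a x = 0 ∧ b x = 0 ∧ c x = 0 ∧ d x = 0 := fun x hx =>
    ⟨by_contra fun h => hx (haK x h), by_contra fun h => hx (hbK x h), by_contra fun h => hx (hcK x h),
      by_contra fun h => hx (hdK x h)⟩
  refine ⟨A, E₁ f₁, E₁ g₁, E₂ f₂, E₂ g₂, α, β, γ, δ, hnn₁ f₁ hf₁, hnn₁ g₁ hg₁, hnn₂ f₂ hf₂, hnn₂ g₂ hg₂,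
    hdet₁ f₁, hdet₁ g₁, hdet₂ f₂, hdet₂ g₂, hα.le, hβ.le, hγ.le, hδ.le, hαβ, fun x => ?_⟩
  by_cases hx : x ∈ K
  · rw [hval₁ f₁ x hx, hval₁ g₁ x hx, hval₂ f₂ x hx, hval₂ g₂ x hx]
    exact hX ⟨x, hx⟩
  · obtain ⟨ha0, hb0, hc0, hd0⟩ := hzero x hx
    rw [mul_assoc α, mul_assoc β, mul_assoc γ, mul_assoc δ, hoff f₁ f₂ x hx, hoff g₁ g₂ x hx,
      hoff f₁ g₂ x hx, hoff g₁ f₂ x hx, mul_zero, mul_zero, mul_zero, mul_zero]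
    exact ⟨ha0, hb0, hc0, hd0⟩

/-- **Theorem 8.3 (AD equality for direct products of chains), [ChanPak2026].**  Let `L = Π_i C_i` be a
direct product of finite chains and `a, b, c, d : L → ℝ≥0` satisfy (AD-cond) `a(x) b(y) ≤ c(x ∨ y) d(x ∧ y)`.
Then `Σa · Σb = Σc · Σd` (AD-eq) if and only if there are `A ⊆ ι`, nonnegative `f₁, g₁` depending only on the
coordinates in `A` (functions on `L₁ = ⊗_{i∈A} C_i`), `f₂, g₂` depending only on those off `A` (functions on
`L₂ = ⊗_{j∉A} C_j`), and constants `α, β, γ, δ ≥ 0` with `αβ = γδ` such that (1.2):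
`a = α f₁ f₂`, `b = β g₁ g₂`, `c = γ f₁ g₂`, `d = δ g₁ f₂`.  (No lattice-closure hypothesis; the constants are
only nonnegative.) [cite: ChanPak2026, Thm. 8.3] -/
theorem chanPak_thm83 {a b c d : (∀ i, C i) → ℝ} (ha : ∀ x, 0 ≤ a x) (hb : ∀ x, 0 ≤ b x) (hc : ∀ x, 0 ≤ c x)
    (hd : ∀ x, 0 ≤ d x) (hAD : ∀ x y, a x * b y ≤ c (x ⊔ y) * d (x ⊓ y)) :
    (∑ x, a x) * ∑ x, b x = (∑ x, c x) * ∑ x, d x ↔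
    ∃ (A : Set ι) (f₁ g₁ f₂ g₂ : (∀ i, C i) → ℝ) (α β γ δ : ℝ),
      (∀ x, 0 ≤ f₁ x) ∧ (∀ x, 0 ≤ g₁ x) ∧ (∀ x, 0 ≤ f₂ x) ∧ (∀ x, 0 ≤ g₂ x) ∧
      DetBy f₁ A ∧ DetBy g₁ A ∧ DetBy f₂ Aᶜ ∧ DetBy g₂ Aᶜ ∧
      0 ≤ α ∧ 0 ≤ β ∧ 0 ≤ γ ∧ 0 ≤ δ ∧ α * β = γ * δ ∧
      ∀ x, a x = α * f₁ x * f₂ x ∧ b x = β * g₁ x * g₂ x ∧ c x = γ * f₁ x * g₂ x ∧ d x = δ * g₁ x * f₂ x :=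
  ⟨exists_crossFactor_pi_of_adEq ha hb hc hd hAD,
    fun ⟨_, _, _, _, _, _, _, _, _, _, _, _, _, hf₁, hg₁, hf₂, hg₂, _, _, _, _, hαβ, hX⟩ =>
      adEq_of_crossFactor_pi hf₁ hg₁ hf₂ hg₂ hαβ hX⟩

end Chains

end Literature.Probability.LatticeModels.FourFunctionsEquality

end
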